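import Summits.Ventures.Crystal3D.Theorems.StickyWulffConstantCoaxialWallLawLaminarEnd
import HarnessLib

/-!
# The off-plane local law: a ball ON a basal plane has at most six on-plane contacts outside its layer — arbitrary fillings

HONEST FRAMING. Part of the venture `Summits/Ventures/Crystal3D` (cell `crystal3d-full`), helper
`--supports` the crux `CoaxialWallLaw` (stmt-Ventures-19481, `route-Ventures-StickyWulffConstant`),
REGISTERED line `WallLedgerF` (planner cf-p1 gen 16), open stub `stub_coaxialTwoSlabAdhesion`.
RUNG CREDIT ONLY; F-C1 not moved.  The laminar local law `…LaminarLocal.laminar_card_contacts_le` with the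
laminarity premise REMOVED: the filling `X` is arbitrary, only the ball `z` under inspection lies on a basal plane
`⟪L⁻¹(z − s), e₃⟫ ∈ √(2/3)·ℤ` of the frame, and the contacts of `z` OFF the basal planes are simply subtracted
(they are the budget of the off-plane law `…CoaxialWallLawOffPlane`, as the off-site contacts were for `…OffSite`):

* **`onPlane_card_contacts_le`** — `X` `1`-separated, `z` on a basal plane:
  `deg z ≤ #{contacts in z's layer} + 6 + #{contacts of z off the basal planes}` (an on-plane contact in another
  layer is exactly one layer away, a unit vector with `⟪u, L e₃⟫² = 2/3`; at most three per side by
  `card_le_three_of_polarCap`).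
* **`onPlane_card_contacts_le_eleven_add_off_of_end`** — if moreover `z − d ∈ X`, `z + d ∉ X` for a unit vector `d`
  of the basal plane, then `deg z ≤ 11 + #{off-plane contacts of z}` (`…LaminarEnd.laminar_inLayer_card_le_five_of_end`,
  which needs no laminarity).

WHAT THIS IS NOT: no count; F-C1 not moved.
-/

noncomputable section

namespace Summit.Ventures.Crystal3D.Theorems

open Summit.Ventures.Crystal3D Finset
open scoped InnerProductSpace

open scoped Classical in
/-- **The off-plane local law.**  See the module docstring. -/
theorem onPlane_card_contacts_le
    (L : EuclideanSpace ℝ (Fin 3) ≃ₗᵢ[ℝ] EuclideanSpace ℝ (Fin 3)) (s : EuclideanSpace ℝ (Fin 3))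
    (X : Finset (EuclideanSpace ℝ (Fin 3)))
    (hX : ∀ p ∈ X, ∀ q ∈ X, p ≠ q → 1 ≤ dist p q)
    {z : EuclideanSpace ℝ (Fin 3)} {kz : ℤ} (hzk : (L.symm (z - s)) 2 = kz * Real.sqrt (2 / 3)) :
    (X.filter fun q => dist z q = 1).card ≤
      (X.filter fun q => dist z q = 1 ∧ (L.symm (q - s)) 2 = (L.symm (z - s)) 2).card + 6 +
        (X.filter fun q => dist z q = 1 ∧ ¬ ∃ k : ℤ, (L.symm (q - s)) 2 = k * Real.sqrt (2 / 3)).card := by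
  set e₃ : EuclideanSpace ℝ (Fin 3) := EuclideanSpace.single (2 : Fin 3) (1 : ℝ) with he₃
  set n : EuclideanSpace ℝ (Fin 3) := L e₃ with hn
  set C : Finset (EuclideanSpace ℝ (Fin 3)) := X.filter fun q => dist z q = 1 with hC
  set Con : Finset (EuclideanSpace ℝ (Fin 3)) := C.filter fun q => ∃ k : ℤ, (L.symm (q - s)) 2 = k * Real.sqrt (2 / 3)
    with hCon
  set Coff : Finset (EuclideanSpace ℝ (Fin 3)) := C.filter fun q => ¬ ∃ k : ℤ, (L.symm (q - s)) 2 = k * Real.sqrt (2 / 3)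
    with hCoff
  have he₃1 : ‖e₃‖ = 1 := by rw [he₃, PiLp.norm_single, norm_one]
  have hn1 : ‖n‖ = 1 := by rw [hn, LinearIsometryEquiv.norm_map, he₃1]
  have hH : Real.sqrt (2 / 3) ^ 2 = 2 / 3 := Real.sq_sqrt (by norm_num)
  have hs0 : 0 < Real.sqrt (2 / 3) := Real.sqrt_pos.2 (by norm_num)
  -- split the contacts by on/off plane
  have hsplit0 : C.card ≤ Con.card + Coff.card := by
    rw [hCon, hCoff, ← card_filter_add_card_filter_not (s := C)
      (p := fun q => ∃ k : ℤ, (L.symm (q - s)) 2 = k * Real.sqrt (2 / 3))]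
  have hCoff_le : Coff.card ≤ (X.filter fun q => dist z q = 1 ∧
      ¬ ∃ k : ℤ, (L.symm (q - s)) 2 = k * Real.sqrt (2 / 3)).card := by
    refine card_le_card ?_
    intro q hq
    rw [hCoff, mem_filter, hC, mem_filter] at hq
    exact mem_filter.2 ⟨hq.1.1, hq.1.2, hq.2⟩
  -- the frame height of a contact relative to `z`
  have hheight : ∀ q : EuclideanSpace ℝ (Fin 3), ⟪q - z, n⟫_ℝ = (L.symm (q - s)) 2 - (L.symm (z - s)) 2 := by
    intro q
    have e : q - z = L (L.symm (q - s) - L.symm (z - s)) := by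
      rw [map_sub, LinearIsometryEquiv.apply_symm_apply, LinearIsometryEquiv.apply_symm_apply]; abel
    rw [e, hn, LinearIsometryEquiv.inner_map_map, EuclideanSpace.inner_single_right, PiLp.sub_apply]
    simp
  -- for an on-plane contact: the layer jump is `-1`, `0` or `1`
  have hjump : ∀ q ∈ Con, ∃ m : ℤ, (m = 0 ∨ m = 1 ∨ m = -1) ∧ ⟪q - z, n⟫_ℝ = m * Real.sqrt (2 / 3) := by
    intro q hq
    rw [hCon, mem_filter, hC, mem_filter] at hq
    obtain ⟨⟨hqX, hqd⟩, kq, hkq⟩ := hq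
    refine ⟨kq - kz, ?_, by rw [hheight, hkq, hzk]; push_cast; ring⟩
    have hu1 : ‖q - z‖ = 1 := by rw [← dist_eq_norm, dist_comm, hqd]
    have hle : |⟪q - z, n⟫_ℝ| ≤ 1 := by
      have := abs_real_inner_le_norm (q - z) n
      rw [hu1, hn1, one_mul] at this
      exact this
    rw [hheight, hkq, hzk, show (kq : ℝ) * Real.sqrt (2 / 3) - kz * Real.sqrt (2 / 3) =
      ((kq - kz : ℤ) : ℝ) * Real.sqrt (2 / 3) by push_cast; ring, abs_mul, abs_of_pos hs0] at hle
    have hm : |((kq - kz : ℤ) : ℝ)| ≤ 3 / 2 := by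
      by_contra hgt
      push Not at hgt
      have : (3 / 2 : ℝ) * Real.sqrt (2 / 3) < |((kq - kz : ℤ) : ℝ)| * Real.sqrt (2 / 3) :=
        mul_lt_mul_of_pos_right hgt hs0
      nlinarith [hH, hs0]
    have h4 : ((kq - kz : ℤ) : ℝ) ≤ 3 / 2 := (le_abs_self _).trans hm
    have h5 : -(3 / 2 : ℝ) ≤ ((kq - kz : ℤ) : ℝ) := by linarith [neg_abs_le (((kq - kz : ℤ)) : ℝ)]
    have h6 : kq - kz ≤ 1 := by
      by_contra h7
      push Not at h7
      have : (2 : ℝ) ≤ ((kq - kz : ℤ) : ℝ) := by exact_mod_cast h7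
      linarith
    have h8 : -1 ≤ kq - kz := by
      by_contra h7
      push Not at h7
      have : ((kq - kz : ℤ) : ℝ) ≤ -2 := by exact_mod_cast (show kq - kz ≤ -2 by omega)
      linarith
    omega
  -- split the on-plane contacts by layer
  set C0 := Con.filter fun q => ⟪q - z, n⟫_ℝ = 0 with hC0
  set Cp := Con.filter fun q => 0 < ⟪q - z, n⟫_ℝ with hCp
  set Cm := Con.filter fun q => ⟪q - z, n⟫_ℝ < 0 with hCm
  have hsplit : Con ⊆ C0 ∪ Cp ∪ Cm := by
    intro q hq
    rcases lt_trichotomy 0 ⟪q - z, n⟫_ℝ with h | h | h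
    · exact mem_union_left _ (mem_union_right _ (mem_filter.2 ⟨hq, h⟩))
    · exact mem_union_left _ (mem_union_left _ (mem_filter.2 ⟨hq, h.symm⟩))
    · exact mem_union_right _ (mem_filter.2 ⟨hq, h⟩)
  have hcardCon : Con.card ≤ C0.card + Cp.card + Cm.card :=
    (card_le_card hsplit).trans ((card_union_le _ _).trans (by
      have := card_union_le C0 Cp; omega))
  -- (1) same layer
  have hC0le : C0.card ≤ (X.filter fun q => dist z q = 1 ∧ (L.symm (q - s)) 2 = (L.symm (z - s)) 2).card := by
    refine card_le_card ?_
    intro q hq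
    rw [hC0, mem_filter, hCon, mem_filter, hC, mem_filter] at hq
    rw [mem_filter]
    refine ⟨hq.1.1.1, hq.1.1.2, ?_⟩
    have := hheight q
    rw [hq.2] at this
    linarith
  -- (2), (3): the caps
  have hcap : ∀ (m : EuclideanSpace ℝ (Fin 3)), (m = n ∨ m = -n) →
      ((Con.filter fun q => 0 < ⟪q - z, m⟫_ℝ).card ≤ 3) := by
    intro m hm
    have hm1 : ‖m‖ = 1 := by rcases hm with rfl | rfl; exact hn1; rw [norm_neg, hn1]
    set Cq := Con.filter fun q => 0 < ⟪q - z, m⟫_ℝ with hCq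
    have hinj : Set.InjOn (fun q => q - z) ↑Cq := by
      intro q _ q' _ hqq'; simpa using hqq'
    rw [← card_image_of_injOn hinj]
    refine card_le_three_of_polarCap hm1 _ ?_ ?_ ?_ ?_
    · intro u hu
      obtain ⟨q, hq, rfl⟩ := mem_image.1 hu
      have hqC := (mem_filter.1 (mem_filter.1 hq).1).1
      rw [hC, mem_filter] at hqC
      rw [← dist_eq_norm, dist_comm]; exact hqC.2
    · intro u hu
      obtain ⟨q, hq, rfl⟩ := mem_image.1 hu
      exact (mem_filter.1 hq).2
    · intro u hu
      obtain ⟨q, hq, rfl⟩ := mem_image.1 hu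
      obtain ⟨hqC, hpos⟩ := mem_filter.1 hq
      obtain ⟨j, hj, hinner⟩ := hjump q hqC
      have hmn : ⟪q - z, m⟫_ℝ ^ 2 = ⟪q - z, n⟫_ℝ ^ 2 := by
        rcases hm with rfl | rfl
        · rfl
        · rw [inner_neg_right, neg_sq]
      rw [hmn, hinner]
      have hj0 : j ≠ 0 := by
        rintro rfl
        have : ⟪q - z, m⟫_ℝ = 0 := by
          rcases hm with rfl | rfl
          · rw [hinner]; simp
          · rw [inner_neg_right, hinner]; simp
        rw [this] at hpos; exact lt_irrefl _ hpos
      have hj1 : (j : ℝ) ^ 2 = 1 := by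
        rcases hj with h | h | h
        · exact absurd h hj0
        · rw [h]; norm_num
        · rw [h]; norm_num
      nlinarith [hj1, hH]
    · intro u hu u' hu' huu'
      obtain ⟨q, hq, rfl⟩ := mem_image.1 hu
      obtain ⟨q', hq', rfl⟩ := mem_image.1 hu'
      have hqC := (mem_filter.1 (mem_filter.1 hq).1).1
      have hq'C := (mem_filter.1 (mem_filter.1 hq').1).1
      rw [hC, mem_filter] at hqC hq'C
      have hne : q ≠ q' := fun h => huu' (by rw [h])
      have hd := hX q hqC.1 q' hq'C.1 hne
      have hu1 : ‖q - z‖ = 1 := by rw [← dist_eq_norm, dist_comm, hqC.2]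
      have hu1' : ‖q' - z‖ = 1 := by rw [← dist_eq_norm, dist_comm, hq'C.2]
      have hdd : dist q q' = ‖(q - z) - (q' - z)‖ := by rw [dist_eq_norm]; congr 1; abel
      have hexp : ‖(q - z) - (q' - z)‖ ^ 2 = ‖q - z‖ ^ 2 - 2 * ⟪q - z, q' - z⟫_ℝ + ‖q' - z‖ ^ 2 :=
        norm_sub_sq_real _ _
      rw [hu1, hu1', ← hdd] at hexp
      nlinarith [hexp, hd]
  have hCp : Cp.card ≤ 3 := hcap n (Or.inl rfl)
  have hCm : Cm.card ≤ 3 := by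
    have h := hcap (-n) (Or.inr rfl)
    have hEq : Cm = Con.filter fun q => 0 < ⟪q - z, -n⟫_ℝ := by
      rw [hCm]; congr 1; ext q; rw [inner_neg_right]; constructor <;> intro h' <;> linarith
    rw [hEq]; exact h
  omega

open scoped Classical in
/-- **The off-plane end law: an in-plane run end with predecessor, ON a basal plane of an arbitrary filling, has
at most eleven contacts plus its off-plane ones.**  See the module docstring. -/
theorem onPlane_card_contacts_le_eleven_add_off_of_end
    (L : EuclideanSpace ℝ (Fin 3) ≃ₗᵢ[ℝ] EuclideanSpace ℝ (Fin 3)) (s : EuclideanSpace ℝ (Fin 3))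
    (X : Finset (EuclideanSpace ℝ (Fin 3)))
    (hX : ∀ p ∈ X, ∀ q ∈ X, p ≠ q → 1 ≤ dist p q)
    {z d : EuclideanSpace ℝ (Fin 3)} {kz : ℤ} (hzk : (L.symm (z - s)) 2 = kz * Real.sqrt (2 / 3))
    (hd1 : ‖d‖ = 1) (hdn : ⟪d, L (EuclideanSpace.single (2 : Fin 3) (1 : ℝ))⟫_ℝ = 0)
    (hpred : z - d ∈ X) (hsucc : z + d ∉ X) :
    (X.filter fun q => dist z q = 1).card ≤
      11 + (X.filter fun q => dist z q = 1 ∧ ¬ ∃ k : ℤ, (L.symm (q - s)) 2 = k * Real.sqrt (2 / 3)).card := by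
  have h1 := onPlane_card_contacts_le L s X hX hzk
  have h2 := laminar_inLayer_card_le_five_of_end L s X hX hd1 hdn hpred hsucc
  omega

end Summit.Ventures.Crystal3D.Theorems

end
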